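import Mathlib
import HarnessLib.Audit
import Summits.PneNP.PneNP.Theorems.PstarUnionCaseAFive
import Summits.PneNP.PneNP.Theorems.PstarMultiUnion

/-!
# Case A of the LOCAL union lemma: `w₂` chord-blind ⟹ `#J₀ ≤ 5` (ROUND-25, memo §14.29 (Rb1) / §14.30; `PstarMultiUnion.LocalUnionFive`)

FRONTIER range-avoidance ladder, rung F-N3, ROUND 25 (cell `pnp-ideate`, planner memo `r24/CORE-BOUND-NOTES.md` §14.29–§14.30, typed target
`PstarMultiUnion.LocalUnionFive` of planner p3 g23; restricted-model proof complexity — nothing here bears on `P` versus `NP`).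

The LOCAL union configuration (`PstarMultiUnion.LocalUnionTerminal`): a core `J₀`, a shared constraint `w₂`, a base reader `A₀`, and for EVERY output `f` some reader
`A_f` — same monomials as `A₀`, linear part differing from `A₀`'s off the XOR slots, `(A_f, w₂)` unsolvable over `J₀` — releasing `f`.  This file re-runs Case A of
the union lemma (`PstarUnionCaseAFive.card_le_five_caseA`, `w₂` chord-blind) for it.  Every use of the union cover in the landed proof resolves it at ONE output:

* hardness (★★) at a chord `e` is `PstarUnionRankSixBridge.forced_of_minimal` for the reader releasing `e` (`wf_update`; `Lift`, `u`, `free₂`, `b₂` are reader-free);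
* `Z(q) ≠ ∅` from the release of one chord; the per-chord trichotomy (EQ)/EXC-unit/(NOR) and the branches (a), (b) see only `q = free₂ + b₂`;
* branch (c) (every chord (EQ), a single chord `e₀`) runs `PstarUnionCaseAEQ1.eq1_caseA` on the bridge data of the reader released at a forest output `j ∈ D e₀`.

* `card_le_five_caseA_local` — the bridge-level statement with the local cover «`∀ f, ∃ (C_f, b_f)`: XOR-agreement with `C₁`, (T3), release of `f`»;
* `exists_local_bridgeData` — local-union-terminal data with admissible `F` and hun package as well-formed liftable bridge data (the packaged reader is one
  released somewhere; every `A_f` becomes an XOR-agreeing update of it);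
* `caseA_local` — **Case A of `LocalUnionFive`**: local-union-terminal + admissible `F` + hun + `w₂` chord-blind ⟹ `#J₀ ≤ 5`.
-/

set_option linter.dupNamespace false -- `Summit.PneNP.PneNP.…`: summit = sub-problem name (D-0017 single-conjunct layout)

open Finset Module Literature.Computability.Complexity
open scoped symmDiff
open Summit.PneNP.PneNP.Theorems.PstarFibrePolys (bit bit_injective)
open Summit.PneNP.PneNP.Theorems.PstarTyped (Typed)
open Summit.PneNP.PneNP.Theorems.PstarSALevel (varSet bdry BoundaryExpanding SimpleOverlap)
open Summit.PneNP.PneNP.Theorems.PstarCoreBound (XorClosed)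
open Summit.PneNP.PneNP.Theorems.PstarGapLinearised (andPair)
open Summit.PneNP.PneNP.Theorems.PstarGapOneAll (gval)
open Summit.PneNP.PneNP.Theorems.PstarXCore (xverts mem_xpair)
open Summit.PneNP.PneNP.Theorems.PstarCubeIdeals (IsAffineFn)
open Summit.PneNP.PneNP.Theorems.PstarProductRank (qform polar)
open Summit.PneNP.PneNP.Theorems.PstarPathRank (AndAdj)
open Summit.PneNP.PneNP.Theorems.PstarForcing (forcing_cases)
open Summit.PneNP.PneNP.Theorems.PstarChordRepair (IsChord)
open Summit.PneNP.PneNP.Theorems.PstarChordBridgeTools (xpdeg privs vars_mem_privs uval free coef bit_gval_eq)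
open Summit.PneNP.PneNP.Theorems.PstarChordBridge (BridgeData sys Solution Lift sys_u)
open Summit.PneNP.PneNP.Theorems.PstarReadSumset (V2)
open Summit.PneNP.PneNP.Theorems.PstarChordBridgeFundamental (eq_of_fundamental_eq two_le_card_of_even)
open Summit.PneNP.PneNP.Theorems.PstarChordBridgeForcing (gam sys_u_eq qform_add' rank_four_of_wf chord_eq_of_EQ coef_of_unread)
open Summit.PneNP.PneNP.Theorems.PstarChordBridgeCotree (Peelable sdiff_nonempty_of_xorClosed)
open Summit.PneNP.PneNP.Theorems.PstarChordBridgeTerminal (HasConstraints)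
open Summit.PneNP.PneNP.Theorems.PstarChordBridgeBasis (qDir polarDir)
open Summit.PneNP.PneNP.Theorems.PstarChordBridgeCorner (qDir_add)
open Summit.PneNP.PneNP.Theorems.PstarNorUnitExcCore (exc_unit_core)
open Summit.PneNP.PneNP.Theorems.PstarNorUnitMixed (false_of_nor_of_excUnit D_eq_of_excUnits card_units_le_five_of_EQ_of_excUnit)
open Summit.PneNP.PneNP.Theorems.PstarNorUnitDirAssembly (xorClosed_units not_EQ_of_nor_dir)
open Summit.PneNP.PneNP.Theorems.PstarNorUnitCoverTools (two_le_xpdeg_of_xorClosed)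
open Summit.PneNP.PneNP.Theorems.PstarNorUnitCover (subset_units)
open Summit.PneNP.PneNP.Theorems.PstarNorUnitFinal (card_le_five_of_regime_nor)
open Summit.PneNP.PneNP.Theorems.PstarNorUnitRegime (J₀_eq_of_single)
open Summit.PneNP.PneNP.Theorems.PstarUnion (SatPair)
open Summit.PneNP.PneNP.Theorems.PstarUnionRankSixBridge (wf_update forced_of_minimal)
open Summit.PneNP.PneNP.Theorems.PstarUnionCaseAEQ1 (qDir_one_zero eq1_caseA)
open Summit.PneNP.PneNP.Theorems.PstarUnionCaseAFive (free₂_eq_of_solution)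
open Summit.PneNP.PneNP.Theorems.PstarUnionBridgeData (exists_bridgeData_of_sat)
open Summit.PneNP.PneNP.Theorems.PstarMultiUnion (LocalUnionTerminal)

namespace Summit.PneNP.PneNP.Theorems.PstarLocalUnionCaseA

variable {n m : ℕ}

/-- In `𝔽₂`, `x + x = 0`. -/
private theorem zmod2_add_self (x : ZMod 2) : x + x = 0 := by
  revert x; decide

/-- In `𝔽₂`, `s + t = 0 ↔ s = t`. -/
private theorem zmod2_add_eq_zero_iff (s t : ZMod 2) : s + t = 0 ↔ s = t := by
  revert s t; decide

/-- Symmetric differences compose: `R ∆ A ⊆ (A₀ ∆ R) ∪ (A₀ ∆ A)`. -/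
private theorem mem_symmDiff_of_mem_symmDiff {α : Type*} [DecidableEq α] {A₀ R A : Finset α} {v : α} (h : v ∈ R ∆ A) :
    v ∈ A₀ ∆ R ∨ v ∈ A₀ ∆ A := by
  rw [mem_symmDiff] at h
  rw [mem_symmDiff, mem_symmDiff]
  by_cases h₀ : v ∈ A₀ <;> tauto

/-! ## Case A at bridge level, local cover -/

/-- **Case A at bridge level with the LOCAL cover: `#J₀ ≤ 5`.**  Well-formed liftable bridge data `B` (second constraint `w₂ = (C₂, G₂, b₂)` chord-blind, hun),
the structural hypotheses of the direction picture, and for every output `f` a reader `(C_f, G₁, b_f)` agreeing with `C₁` on the XOR vertices, with (T3), released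
by `f`.  (`PstarUnionCaseAFive.card_le_five_caseA` is the case of two readers.) -/
theorem card_le_five_caseA_local (I : LocalMap 4 n m) (hI : I.IsPure xorAndPred) (hT : Typed I) (hS : SimpleOverlap I) {r : ℕ}
    (hB : BoundaryExpanding r I) {B : BridgeData n m} (hW : B.WF I) (hJr : B.J₀.card < r) (hr : (B.J₀ ∪ B.G₁ ∪ B.G₂).card ≤ r)
    (hX : XorClosed I B.J₀) (hP : Peelable I (B.J₀ \ B.N)) (hG₁ : Disjoint B.G₁ B.J₀) (hG₂ : Disjoint B.G₂ B.J₀) (hN : B.N.Nonempty)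
    (hL : Lift I B)
    (hun : ∀ v ∈ privs I B.N, (∀ g ∈ B.G₁, I.vars g 2 ≠ v ∧ I.vars g 3 ≠ v) ∧ ∀ g ∈ B.G₂, I.vars g 2 ≠ v ∧ I.vars g 3 ≠ v)
    (hblind : ∀ v ∈ privs I B.N, v ∉ B.C₂)
    (hloc : ∀ f ∈ B.J₀, ∃ (C' : Finset (Fin n)) (b' : Bool), (∀ v ∈ B.C₁ ∆ C', v ∉ xverts I (B.J₀ \ B.N)) ∧
      (¬ ∃ z, Solution I { B with C₁ := C', b₁ := b' } B.J₀ z) ∧ ∃ z, Solution I { B with C₁ := C', b₁ := b' } (B.J₀.erase f) z) :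
    B.J₀.card ≤ 5 := by
  classical
  have e1 : ∀ g Q : ZMod 2, g + Q = 1 → Q = g + 1 := by decide
  set mv : V2 := ((1 : ZMod 2), (0 : ZMod 2)) with hmv
  -- hardness: every chord is forced on `Z(q)` — (★★) for the reader releasing it
  have hforced : ∀ e ∈ B.N, ∀ a, free I B.y (B.J₀ \ B.N) B.N B.T₂ B.C₂ B.G₂ a = bit B.b₂ → uval I B.y (B.D e) e a = 1 := by
    intro e he a ha
    obtain ⟨C', b', hC, hT3', hrel⟩ := hloc e (hW.hN he)
    exact forced_of_minimal I hI hT (wf_update hW b' hC) hL hun hblind hT3' he hrel ha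
  have hZc : ∀ e ∈ B.N, ∀ x, qDir I B mv x = 0 → qform (B.D e) (fun j => I.vars j 2) (fun j => I.vars j 3) x = gam B e + 1 := by
    intro e he x hx
    rw [hmv, qDir_one_zero] at hx
    have h := hforced e he x ((zmod2_add_eq_zero_iff _ _).1 hx)
    have hu := sys_u_eq I B e x
    rw [sys_u] at hu
    rw [hu] at h
    exact e1 _ _ h
  -- `Z(q) ≠ ∅`: the release of a chord gives a forest solution with `w₂`
  have hZne : ∃ a, free I B.y (B.J₀ \ B.N) B.N B.T₂ B.C₂ B.G₂ a = bit B.b₂ := by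
    obtain ⟨c, hc⟩ := hN
    have hsub : B.J₀ \ B.N ⊆ B.J₀.erase c := fun j hj => mem_erase.2 ⟨fun h => (mem_sdiff.1 hj).2 (h ▸ hc), (mem_sdiff.1 hj).1⟩
    obtain ⟨C', b', -, -, z, hzK, -, hz2⟩ := hloc c (hW.hN hc)
    exact ⟨_, free₂_eq_of_solution I hI hT hW (fun v hv => (hun v hv).2) hblind (fun j hj => hzK j (hsub hj)) hz2⟩
  obtain ⟨a₀, ha₀⟩ := hZne
  have hq0 : qDir I B mv a₀ = 0 := by rw [hmv, qDir_one_zero, ha₀]; exact zmod2_add_self _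
  have heG : ∀ e ∈ B.N, e ∉ B.G₁ ∪ B.G₂ := fun e he h => by
    rcases mem_union.1 h with h | h
    · exact Finset.disjoint_left.1 hG₁ h (hW.hN he)
    · exact Finset.disjoint_left.1 hG₂ h (hW.hN he)
  have hqB : ∀ x w, qDir I B mv (x + w) = qDir I B mv x + qDir I B mv w + qDir I B mv 0 + polarDir I B mv x w := qDir_add I B mv
  -- per chord: (EQ) / EXC-unit / (NOR)
  have hcls : ∀ e ∈ B.N,
      (∃ κ : ZMod 2, ∀ x, qform (B.D e) (fun j => I.vars j 2) (fun j => I.vars j 3) x = qDir I B mv x + κ) ∨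
      (∃ j₁ j₂ : Fin m, ∃ σ τ : Fin n, j₁ ≠ j₂ ∧ B.D e = {j₁, j₂} ∧ Disjoint (andPair I j₁) (andPair I j₂) ∧
        σ ∈ andPair I j₁ ∧ τ ∈ andPair I j₂ ∧
        ∀ v w : Fin n, polarDir I B mv (Pi.single v 1) (Pi.single w 1) =
          (if AndAdj I (B.D e) v w then 1 else 0) + (if (v = σ ∧ w = τ) ∨ (v = τ ∧ w = σ) then 1 else 0)) ∨
      (∃ a b : Fin n → ZMod 2, polarDir I B mv a b = 1 ∧
        (∀ x, qDir I B mv x =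
          (polarDir I B mv x b + (qDir I B mv b + qDir I B mv 0)) * (polarDir I B mv x a + (qDir I B mv a + qDir I B mv 0)) + 1) ∧
        ∃ m₁ m₂ : (Fin n → ZMod 2) → ZMod 2, IsAffineFn m₁ ∧ IsAffineFn m₂ ∧
          ∀ x, qform (B.D e) (fun j => I.vars j 2) (fun j => I.vars j 3) x + (gam B e + 1) =
            (polarDir I B mv x b + (qDir I B mv b + qDir I B mv 0) + 1) * m₁ x +
            (polarDir I B mv x a + (qDir I B mv a + qDir I B mv 0) + 1) * m₂ x) := by
    intro e he
    rcases forcing_cases hqB (qform_add' I (B.D e)) (rank_four_of_wf I hI hS hB hW hJr.le he) (hZc e he) with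
        h1 | h | ⟨ν₁, ν₂, hν₁, hν₂, κ, h⟩ | h
    · exact absurd (h1 a₀) (by rw [hq0]; exact zero_ne_one)
    · exact Or.inl h
    · rcases exc_unit_core I hI hS hB hW hr he (heG e he) mv hqB (hZc e he) hν₁ hν₂ h with h' | ⟨j₁, j₂, σ, τ, hne, hDe, hdisj, hσ, hτ, -, hform, -⟩
      · exact Or.inl h'
      · exact Or.inr (Or.inl ⟨j₁, j₂, σ, τ, hne, hDe, hdisj, hσ, hτ, hform⟩)
    · exact Or.inr (Or.inr h)
  -- (a) some (NOR) chord ⟹ every chord (NOR)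
  by_cases hNOR : ∃ e ∈ B.N, ∃ a b : Fin n → ZMod 2, polarDir I B mv a b = 1 ∧
      (∀ x, qDir I B mv x =
        (polarDir I B mv x b + (qDir I B mv b + qDir I B mv 0)) * (polarDir I B mv x a + (qDir I B mv a + qDir I B mv 0)) + 1) ∧
      ∃ m₁ m₂ : (Fin n → ZMod 2) → ZMod 2, IsAffineFn m₁ ∧ IsAffineFn m₂ ∧
        ∀ x, qform (B.D e) (fun j => I.vars j 2) (fun j => I.vars j 3) x + (gam B e + 1) =
          (polarDir I B mv x b + (qDir I B mv b + qDir I B mv 0) + 1) * m₁ x +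
          (polarDir I B mv x a + (qDir I B mv a + qDir I B mv 0) + 1) * m₂ x
  · obtain ⟨e₁, he₁, a₁, b₁, -, hq₁, -⟩ := hNOR
    refine card_le_five_of_regime_nor I hI hT hS hB hW hr hJr hX hP hG₁ hG₂ hN mv fun e he => ?_
    rcases hcls e he with ⟨κ, hκ⟩ | ⟨j₁, j₂, σ, τ, -, hDe, hdisj, hσ, hτ, hform⟩ | h
    · exact (not_EQ_of_nor_dir I hI hS hB hW hJr.le mv hq₁ he hκ).elim
    · exact (false_of_nor_of_excUnit I hI hDe hdisj hσ hτ hform hq₁).elim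
    · exact h
  -- (b) no (NOR) chord, some EXC-unit `e`
  by_cases hUNIT : ∃ e ∈ B.N, ∃ j₁ j₂ : Fin m, ∃ σ τ : Fin n, j₁ ≠ j₂ ∧ B.D e = {j₁, j₂} ∧ Disjoint (andPair I j₁) (andPair I j₂) ∧
      σ ∈ andPair I j₁ ∧ τ ∈ andPair I j₂ ∧
      ∀ v w : Fin n, polarDir I B mv (Pi.single v 1) (Pi.single w 1) =
        (if AndAdj I (B.D e) v w then 1 else 0) + (if (v = σ ∧ w = τ) ∨ (v = τ ∧ w = σ) then 1 else 0)
  · obtain ⟨e, he, j₁, j₂, σ, τ, hne, hDe, hdisj, hσ, hτ, hform⟩ := hUNIT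
    have heD : e ∉ B.D e := fun h => (mem_sdiff.1 (hW.hD e he h)).2 he
    have hother : ∀ e' ∈ B.N, e' ≠ e →
        ∃ κ : ZMod 2, ∀ x, qform (B.D e') (fun j => I.vars j 2) (fun j => I.vars j 3) x = qDir I B mv x + κ := by
      intro e' he' hne'
      rcases hcls e' he' with h | ⟨k₁, k₂, σ', τ', hne'', hDe', hdisj', hσ', hτ', hform'⟩ | h
      · exact h
      · exfalso
        have hDD : B.D e' = B.D e := D_eq_of_excUnits I hI hS hDe hdisj hσ hτ hform hne'' hDe' hdisj' hσ' hτ' hform'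
        have he'D : e' ∉ B.D e := fun h => (mem_sdiff.1 (hW.hD e' he' (hDD ▸ h))).2 he'
        have heven' : ∀ w, Even (xpdeg I (insert e' (B.D e)) w) := fun w => by
          have h := hW.hDeven e' he' w
          rwa [hDD] at h
        exact hne' (eq_of_fundamental_eq I hI hS he'D heD heven' (hW.hDeven e he))
      · exact absurd ⟨e', he', h⟩ hNOR
    by_cases hsingle : ∀ e' ∈ B.N, e' = e
    · have hNe : B.N = {e} := eq_singleton_iff_unique_mem.2 ⟨he, hsingle⟩
      have h3 : B.J₀.card = 3 := by
        rw [J₀_eq_of_single I hI hT hW hX hP hNe, card_insert_of_notMem heD, hDe, card_pair hne]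
      omega
    · push Not at hsingle
      obtain ⟨e', he', hne'⟩ := hsingle
      obtain ⟨κ', hκ'⟩ := hother e' he' hne'
      have hNe : B.N = {e, e'} := by
        refine Subset.antisymm (fun f hf => ?_) fun f hf => ?_
        · rw [mem_insert, mem_singleton]
          by_cases hfe : f = e
          · exact Or.inl hfe
          · obtain ⟨κf, hκf⟩ := hother f hf hfe
            exact Or.inr (chord_eq_of_EQ I hI hS hW hf he' hκf hκ')
        · rw [mem_insert, mem_singleton] at hf
          rcases hf with rfl | rfl
          · exact he
          · exact he'
      have h5 := card_units_le_five_of_EQ_of_excUnit I hI hS hDe hdisj hσ hτ hform hqB hκ' hNe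
      exact le_trans (card_le_card (subset_units I hI hS hW.hN hP hW.hD hW.hDeven (two_le_xpdeg_of_xorClosed I hT hX)
        (two_le_xpdeg_of_xorClosed I hT (xorClosed_units I hI hW)) h5)) h5
  -- (c) every chord (EQ): a single chord; the reader released at a forest output of its cycle runs `eq1_caseA`
  have hEQ : ∀ e ∈ B.N, ∃ κ : ZMod 2, ∀ x, qform (B.D e) (fun j => I.vars j 2) (fun j => I.vars j 3) x = qDir I B mv x + κ := by
    intro e he
    rcases hcls e he with h | h | h
    · exact h
    · exact absurd ⟨e, he, h⟩ hUNIT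
    · exact absurd ⟨e, he, h⟩ hNOR
  obtain ⟨e₁, he₁⟩ := hN
  obtain ⟨κ₁, hκ₁⟩ := hEQ e₁ he₁
  have hNe : B.N = {e₁} := by
    refine eq_singleton_iff_unique_mem.2 ⟨he₁, fun e he => ?_⟩
    obtain ⟨κ, hκ⟩ := hEQ e he
    exact chord_eq_of_EQ I hI hS hW he he₁ hκ hκ₁
  have he₁D : e₁ ∉ B.D e₁ := fun h => (mem_sdiff.1 (hW.hD e₁ he₁ h)).2 he₁
  have hD2 : 2 ≤ (B.D e₁).card := two_le_card_of_even I hI hS he₁D (hW.hDeven e₁ he₁)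
  obtain ⟨j, hj⟩ : (B.D e₁).Nonempty := card_pos.1 (by omega)
  have hjJ : j ∈ B.J₀ := (mem_sdiff.1 (hW.hD e₁ he₁ hj)).1
  obtain ⟨C', b', hC, hT3', z, hz⟩ := hloc j hjJ
  have hκ₁' : ∀ x, qform (B.D e₁) (fun j => I.vars j 2) (fun j => I.vars j 3) x =
      qDir I ({ B with C₁ := C', b₁ := b' } : BridgeData n m) ((1 : ZMod 2), (0 : ZMod 2)) x + κ₁ := fun x => by
    rw [qDir_one_zero]
    have h := hκ₁ x
    rw [hmv, qDir_one_zero] at h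
    exact h
  have h3 := eq1_caseA I hI hT hS hB (wf_update hW b' hC) hr hX hP hG₁ hG₂ hL hun hblind hT3' hforced ⟨a₀, ha₀⟩ hNe hκ₁' hj hz
  have h3' : B.J₀.card = 3 := h3
  omega

/-! ## Packaging local-union-terminal data -/

/-- **Bridge data for a local-union-terminal core.**  Local-union-terminal `(J₀; A₀, w₂)` (`PstarMultiUnion.LocalUnionTerminal`) on a pure typed `(r,3/2)`-expanding
instance with simple overlaps, a maximal peelable `F ⊆ J₀` whose complement consists of chords, hun.  Then some reader `R` released by an output packages with `w₂`
as well-formed liftable bridge data `B` (`B.N = J₀ ∖ F`, `B.G₁ = A₀`'s monomials, second constraint `w₂`), hun holds in bridge form, and the local cover holds in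
`Solution` form: every output `f` is released by an XOR-agreeing update `(C_f, b_f)` of the first constraint satisfying (T3). -/
theorem exists_local_bridgeData (I : LocalMap 4 n m) (hI : I.IsPure xorAndPred) (hT : Typed I) (hS : SimpleOverlap I) {r : ℕ}
    (hB : BoundaryExpanding r I) {y : Fin m → Bool} {J₀ : Finset (Fin m)} {A₀ w₂ : Finset (Fin n) × Finset (Fin m) × Bool}
    (hU : LocalUnionTerminal I r y J₀ A₀ w₂) {F : Finset (Fin m)} (hF : F ⊆ J₀) (hP : Peelable I F)
    (hmax : ∀ F', F ⊆ F' → F' ⊆ J₀ → Peelable I F' → F' = F) (hchord : ∀ e ∈ J₀ \ F, IsChord I J₀ e)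
    (hun : ∀ g ∈ A₀.2.1 ∪ w₂.2.1, ∀ v ∈ privs I (J₀ \ F), I.vars g 2 ≠ v ∧ I.vars g 3 ≠ v) :
    ∃ B : BridgeData n m,
      B.y = y ∧ B.J₀ = J₀ ∧ B.N = J₀ \ F ∧ B.G₁ = A₀.2.1 ∧ B.C₂ = w₂.1 ∧ B.G₂ = w₂.2.1 ∧ B.b₂ = w₂.2.2 ∧ B.WF I ∧ Lift I B ∧ B.T₂ ⊆ F ∧
      Disjoint B.G₁ B.J₀ ∧ Disjoint B.G₂ B.J₀ ∧ B.J₀.Nonempty ∧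
      (∀ v ∈ privs I B.N, (∀ g ∈ B.G₁, I.vars g 2 ≠ v ∧ I.vars g 3 ≠ v) ∧ ∀ g ∈ B.G₂, I.vars g 2 ≠ v ∧ I.vars g 3 ≠ v) ∧
      (∀ f ∈ B.J₀, ∃ (C' : Finset (Fin n)) (b' : Bool), (∀ v ∈ B.C₁ ∆ C', v ∉ xverts I (B.J₀ \ B.N)) ∧
        (¬ ∃ z, Solution I { B with C₁ := C', b₁ := b' } B.J₀ z) ∧ ∃ z, Solution I { B with C₁ := C', b₁ := b' } (B.J₀.erase f) z) := by
  classical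
  obtain ⟨hne, -, hJr, hd₀, hd₂, -, -, hloc⟩ := hU
  have hFN : J₀ \ (J₀ \ F) = F := Finset.sdiff_sdiff_eq_self hF
  -- a reader released somewhere
  obtain ⟨f₀, hf₀⟩ := id hne
  obtain ⟨R, hRG, hRx, hRT3, zR, -, hzR1, hzR2⟩ := hloc f₀ hf₀
  have hd₁ : Disjoint J₀ R.2.1 := by rw [hRG]; exact hd₀
  have hunR : ∀ g ∈ R.2.1 ∪ w₂.2.1, ∀ v ∈ privs I (J₀ \ F), I.vars g 2 ≠ v ∧ I.vars g 3 ≠ v := by rw [hRG]; exact hun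
  have hcross : ∀ g ∈ R.2.1 ∪ w₂.2.1, ¬ (I.vars g 2 ∈ privs I (J₀ \ F) ∧ I.vars g 3 ∈ privs I (J₀ \ F)) :=
    fun g hg h => (hunR g hg _ h.1).1 rfl
  have hT3R : ¬ ∃ z : Fin n → Bool, (∀ j ∈ J₀, I.eval z j = y j) ∧ gval I R.1 R.2.1 z = R.2.2 ∧ gval I w₂.1 w₂.2.1 z = w₂.2.2 := hRT3
  obtain ⟨B, hy, hJ, hN, ⟨hC1, hG1, hb1, hC2, hG2, hb2⟩, hW, hL, hT₂F⟩ :=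
    exists_bridgeData_of_sat I hI hT hS hB y hJr.le R w₂ hd₁ hd₂ hT3R ⟨zR, hzR1, hzR2⟩ hF hP hmax hchord hcross
  subst hy hJ
  refine ⟨B, rfl, rfl, hN, by rw [hG1, hRG], hC2, hG2, hb2, hW, hL, hT₂F, ?_, ?_, hne, ?_, fun f hf => ?_⟩
  · rw [hG1]; exact hd₁.symm
  · rw [hG2]; exact hd₂.symm
  · intro v hv
    rw [hN] at hv
    rw [hG1, hG2]
    exact ⟨fun g hg => hunR g (mem_union_left _ hg) v hv, fun g hg => hunR g (mem_union_right _ hg) v hv⟩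
  · obtain ⟨A, hAG, hAx, hAT3, zA, hzAJ, hzA1, hzA2⟩ := hloc f hf
    refine ⟨A.1, A.2.2, fun v hv hvx => ?_, ?_, ⟨zA, hzAJ, ?_, ?_⟩⟩
    · rw [hC1] at hv
      rw [hN, hFN] at hvx
      obtain ⟨j, hj, hvj⟩ := mem_biUnion.1 hvx
      rcases mem_symmDiff_of_mem_symmDiff (A₀ := A₀.1) hv with h | h
      · rcases (mem_xpair I).1 hvj with h' | h'
        · exact (hRx v h j (hF hj)).1 h'.symm
        · exact (hRx v h j (hF hj)).2 h'.symm
      · rcases (mem_xpair I).1 hvj with h' | h'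
        · exact (hAx v h j (hF hj)).1 h'.symm
        · exact (hAx v h j (hF hj)).2 h'.symm
    · rintro ⟨z, hzJ, hz1, hz2⟩
      have hz1' : gval I A.1 B.G₁ z = A.2.2 := hz1
      have hz2' : gval I B.C₂ B.G₂ z = B.b₂ := hz2
      rw [hG1, hRG, ← hAG] at hz1'
      rw [hC2, hG2, hb2] at hz2'
      exact hAT3 ⟨z, hzJ, hz1', hz2'⟩
    · show gval I A.1 B.G₁ zA = A.2.2
      rw [hG1, hRG, ← hAG]; exact hzA1
    · show gval I B.C₂ B.G₂ zA = B.b₂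
      rw [hC2, hG2, hb2]; exact hzA2

/-! ## Case A of the local union lemma -/

/-- **Case A of `LocalUnionFive`**: local-union-terminal core, admissible `F`, hun, `w₂` chord-blind ⟹ `#J₀ ≤ 5`. -/
theorem caseA_local (I : LocalMap 4 n m) (hI : I.IsPure xorAndPred) (hT : Typed I) (hS : SimpleOverlap I) {r : ℕ}
    (hB : BoundaryExpanding r I) {y : Fin m → Bool} {J₀ : Finset (Fin m)} {A₀ w₂ : Finset (Fin n) × Finset (Fin m) × Bool}
    (hU : LocalUnionTerminal I r y J₀ A₀ w₂) {F : Finset (Fin m)} (hF : F ⊆ J₀) (hP : Peelable I F)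
    (hmax : ∀ F', F ⊆ F' → F' ⊆ J₀ → Peelable I F' → F' = F) (hchord : ∀ e ∈ J₀ \ F, IsChord I J₀ e)
    (hun : ∀ g ∈ A₀.2.1 ∪ w₂.2.1, ∀ v ∈ privs I (J₀ \ F), I.vars g 2 ≠ v ∧ I.vars g 3 ≠ v)
    (hblind : ∀ v ∈ privs I (J₀ \ F), v ∉ w₂.1) : J₀.card ≤ 5 := by
  classical
  have hX : XorClosed I J₀ := hU.2.1
  have hJr : J₀.card < r := hU.2.2.1
  have hcard : (J₀ ∪ A₀.2.1 ∪ w₂.2.1).card ≤ r := hU.2.2.2.2.2.1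
  obtain ⟨B, hy, hJ, hN, hG1, hC2, hG2, -, hW, hL, -, hD₁, hD₂, -, hunB, hloc⟩ :=
    exists_local_bridgeData I hI hT hS hB hU hF hP hmax hchord hun
  have hFN : J₀ \ (J₀ \ F) = F := Finset.sdiff_sdiff_eq_self hF
  have hJr' : B.J₀.card < r := by rw [hJ]; exact hJr
  have hr' : (B.J₀ ∪ B.G₁ ∪ B.G₂).card ≤ r := by rw [hJ, hG1, hG2]; exact hcard
  have hX' : XorClosed I B.J₀ := by rw [hJ]; exact hX
  have hP' : Peelable I (B.J₀ \ B.N) := by rw [hJ, hN, hFN]; exact hP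
  have hN' : B.N.Nonempty := by rw [hN]; exact sdiff_nonempty_of_xorClosed I hT hX hU.1 hF hP
  have hblind' : ∀ v ∈ privs I B.N, v ∉ B.C₂ := by rw [hN, hC2]; exact hblind
  have h := card_le_five_caseA_local I hI hT hS hB hW hJr' hr' hX' hP' hD₁ hD₂ hN' hL hunB hblind' hloc
  rw [hJ] at h
  exact h

end Summit.PneNP.PneNP.Theorems.PstarLocalUnionCaseA
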